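import Summits.SmoothPoincare4.SmoothPoincare4.Theorems.SullivanDualTargetOfSympcap
import Literature.Geometry.Symplectic.GromovR4StdModel

/-!
# SmoothPoincare4 / SullivanDual — crux `Target` (stmt-SmoothPoincare4-7823), line `kaehler-jacket`,
# stub `stub_standardEnd`: the standard end of a capped jacket form

Let `M` be a smooth Hausdorff `4`-manifold, `p, q ∈ M`, `F : M ∖ p → ℝ⁴` a map which agrees with
the inverted recentred chart `ι ∘ (e_p − e_p p)` on a punctured chart-ball at `p`
(`AgreesWithInvertedChartNear p F`, `e_p = extChartAt (𝓡 4) p`), and `sf` a smooth, closed,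
pointwise non-degenerate `2`-form on `M ∖ p` which equals `F*ω₀` at every point OFF the closed
chart-ball `B̄_μ(q) = {x | x ∈ (chartAt q).source, ‖e_q x − e_q q‖ ≤ μ}` about `q`, where the closed
`μ`-ball about `e_q q` lies in the chart target and its `e_q⁻¹`-image misses `p`.  Then `sf` is
symplectic and standard near `p`: `IsSymplecticStandardNearPoint p ε sf` for some `ε > 0`
(`isSymplecticStandardNearPoint_of_eq_off_closedChartBall`), and in particular for the carrier of
a homotopy `4`-sphere (`stub_standardEnd`, the registered signature of the line's skeleton).

Construction.
* (`exists_radius_avoiding_closedChartBall`) The set `K = e_q.symm '' closedBall (e_q q) μ ⊆ M`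
  is compact (continuous image of a compact ball, `e_q.symm` being continuous on the target),
  hence closed (`M` is Hausdorff), and `p ∉ K`; so `Kᶜ` is a neighbourhood of `p`, its preimage
  under `e_p.symm` is a neighbourhood of `e_p p` (`extChartAt_preimage_mem_nhds`) and contains a
  ball of some radius `ε₀ > 0`.  A point `x` of the chart source at `p` with `e_p x` in that ball
  is `e_p.symm (e_p x) ∈ Kᶜ`, so it is not in `B̄_μ(q)` (a point of `B̄_μ(q)` is
  `e_q.symm (e_q x)` with `e_q x ∈ closedBall (e_q q) μ`, i.e. lies in `K`).
* (`isSymplecticStandardNearPoint_of_eq_off_closedChartBall`) With `ε = min ε₀ ε_F`, at a point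
  `x` of the punctured `ε`-chart-ball `sf_x(v, w) = ω₀(dF v, dF w)`; the punctured `ε_F`-ball is
  open (`isOpen_setOf_inPuncturedChartBall`) and `F = ι ∘ (e_p − e_p p)` on it, so
  `dF_x = Dι(e_p x − e_p p) ∘ De_p` by the chain rule (`hasMFDerivAt_inversion_extChartAt_sub`,
  `HasMFDerivAt.congr_of_eventuallyEq`), whence `sf_x(v, w) = (ι*ω₀)_{e_p x − e_p p}(De_p v, De_p w)`
  verbatim (`invertedStdForm`).  This is the template `isSymplecticStandardNearPoint_pullback` of
  `Literature/Geometry/Symplectic/GromovR4StdModel.lean` with the global diffeomorphism replaced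
  by a form prescribed only off a compact cap.

References: M. Gromov, *Pseudo holomorphic curves in symplectic manifolds*, Invent. Math. 82
(1985), §0.3.C [Gromov1985]; D. McDuff, D. Salamon, *J-holomorphic curves and symplectic
topology*, 2nd ed. (2012), §9.4 [McDuffSalamon2012].
-/

noncomputable section

-- the registered namespace `Summit.SmoothPoincare4.SmoothPoincare4.Theorems` repeats a component
set_option linter.dupNamespace false

open scoped Manifold ContDiff Topology
open Set Function
open Literature.Geometry.Kaehler (MForm IsSmoothForm IsClosedForm mextDeriv)
open Literature.Geometry.Symplectic (punctured InPuncturedChartBall stdSymplecticForm inversion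
  invertedStdForm IsSymplecticStandardNearPoint AgreesWithInvertedChartNear)
open Literature.Topology.FourManifolds (HomotopySphere)

namespace Summit.SmoothPoincare4.SmoothPoincare4.Theorems.Target.KaehlerJacket

/-- Model space `ℝ⁴ = ℂ²`. -/
local notation "E4" => EuclideanSpace ℝ (Fin 4)

section General

variable {M : Type*} [TopologicalSpace M] [T2Space M] [ChartedSpace E4 M]

/-- **A radius at `p` avoiding the compact cap about `q`.**  If the closed `μ`-ball about `e_q q`
lies in the target of `e_q = extChartAt (𝓡 4) q` and its image under `e_q.symm` misses `p`, then
there is `ε₀ > 0` such that no point `x` of the chart source at `p` with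
`e_p x ∈ ball (e_p p) ε₀` lies in the closed chart-ball
`{x ∈ (chartAt q).source | ‖e_q x − e_q q‖ ≤ μ}`: the set `e_q.symm '' closedBall (e_q q) μ` is
compact, hence closed in the Hausdorff space `M`, and misses `p`, so its complement pulls back
under `e_p.symm` to a neighbourhood of `e_p p`. [folklore] -/
theorem exists_radius_avoiding_closedChartBall (p q : M) (μ : ℝ)
    (hball : Metric.closedBall (extChartAt (𝓡 4) q q) μ ⊆ (extChartAt (𝓡 4) q).target)
    (havoid : ∀ y ∈ Metric.closedBall (extChartAt (𝓡 4) q q) μ, (extChartAt (𝓡 4) q).symm y ≠ p) :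
    ∃ ε₀ : ℝ, 0 < ε₀ ∧ ∀ x : M, x ∈ (chartAt E4 p).source →
      extChartAt (𝓡 4) p x ∈ Metric.ball (extChartAt (𝓡 4) p p) ε₀ →
      ¬ (x ∈ (chartAt E4 q).source ∧ ‖extChartAt (𝓡 4) q x - extChartAt (𝓡 4) q q‖ ≤ μ) := by
  set eq := extChartAt (𝓡 4) q with heq
  set ep := extChartAt (𝓡 4) p with hep
  -- the compact cap `K = e_q⁻¹(closedBall (e_q q) μ)`
  set K : Set M := eq.symm '' Metric.closedBall (eq q) μ with hK
  have hKc : IsCompact K :=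
    (isCompact_closedBall (eq q) μ).image_of_continuousOn
      ((continuousOn_extChartAt_symm (I := 𝓡 4) q).mono hball)
  have hpK : p ∉ K := by
    rintro ⟨y, hy, hyp⟩
    exact havoid y hy hyp
  have hnhds : Kᶜ ∈ 𝓝 p := hKc.isClosed.isOpen_compl.mem_nhds hpK
  have hpre : ep.symm ⁻¹' Kᶜ ∈ 𝓝 (ep p) := extChartAt_preimage_mem_nhds (I := 𝓡 4) hnhds
  obtain ⟨ε₀, hε₀, hsub⟩ := Metric.mem_nhds_iff.1 hpre
  refine ⟨ε₀, hε₀, ?_⟩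
  rintro x hxs hxb ⟨hxq, hle⟩
  have hxs' : x ∈ ep.source := by
    rw [hep, extChartAt_source]
    exact hxs
  have hxK : x ∉ K := by
    have h1 : ep x ∈ ep.symm ⁻¹' Kᶜ := hsub hxb
    rw [Set.mem_preimage, ep.left_inv hxs'] at h1
    exact h1
  have hxq' : x ∈ eq.source := by
    rw [heq, extChartAt_source]
    exact hxq
  refine hxK ⟨eq x, ?_, eq.left_inv hxq'⟩
  rw [Metric.mem_closedBall, dist_eq_norm]
  exact hle

variable [IsManifold (𝓡 4) ∞ M]

/-- **The standard end of a capped jacket form.**  Let `F : M ∖ p → ℝ⁴` agree with the inverted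
recentred chart `ι ∘ (e_p − e_p p)` on a punctured chart-ball at `p`, let the closed `μ`-chart-ball
about `q` lie in its chart and miss `p`, and let `sf` be a smooth, closed, pointwise non-degenerate
`2`-form on `M ∖ p` equal to `F*ω₀` off that closed ball.  Then `sf` is symplectic and standard
near `p` for some radius `ε`: by `exists_radius_avoiding_closedChartBall` a small punctured
chart-ball at `p` avoids the cap, there `sf = F*ω₀` and, the punctured ball of agreement being
open, `dF_x = Dι(e_p x − e_p p) ∘ De_p` by the chain rule, so
`sf_x(v, w) = (ι*ω₀)_{e_p x − e_p p}(De_p v, De_p w)`.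
[cite: Gromov1985, §0.3.C] -/
theorem isSymplecticStandardNearPoint_of_eq_off_closedChartBall (p q : M) (F : punctured p → E4)
    (μ : ℝ) (sf : MForm (𝓡 4) (punctured p) ℝ 2) (hagree : AgreesWithInvertedChartNear p F)
    (hball : Metric.closedBall (extChartAt (𝓡 4) q q) μ ⊆ (extChartAt (𝓡 4) q).target)
    (havoid : ∀ y ∈ Metric.closedBall (extChartAt (𝓡 4) q q) μ, (extChartAt (𝓡 4) q).symm y ≠ p)
    (hs : IsSmoothForm sf) (hc : IsClosedForm sf)
    (hnd : ∀ (x : punctured p) (v : TangentSpace (𝓡 4) x), v ≠ 0 → ∃ w, sf x ![v, w] ≠ 0)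
    (hoff : ∀ x : punctured p,
      ¬ (x.1 ∈ (chartAt E4 q).source ∧ ‖extChartAt (𝓡 4) q x.1 - extChartAt (𝓡 4) q q‖ ≤ μ) →
      ∀ v w : TangentSpace (𝓡 4) x, sf x ![v, w] =
        stdSymplecticForm (mfderiv (𝓡 4) 𝓘(ℝ, E4) F x v) (mfderiv (𝓡 4) 𝓘(ℝ, E4) F x w)) :
    ∃ ε : ℝ, IsSymplecticStandardNearPoint p ε sf := by
  obtain ⟨εF, hεF, hF⟩ := hagree
  obtain ⟨ε₀, hε₀, h₀⟩ := exists_radius_avoiding_closedChartBall p q μ hball havoid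
  refine ⟨min ε₀ εF, lt_min hε₀ hεF, hs, hc, hnd, ?_⟩
  intro x hxs hxb v w
  have hxb₀ : extChartAt (𝓡 4) p x.1 ∈ Metric.ball (extChartAt (𝓡 4) p p) ε₀ :=
    Metric.ball_subset_ball (min_le_left _ _) hxb
  have hxbF : extChartAt (𝓡 4) p x.1 ∈ Metric.ball (extChartAt (𝓡 4) p p) εF :=
    Metric.ball_subset_ball (min_le_right _ _) hxb
  -- `x` is off the cap, so `sf_x = (F*ω₀)_x`
  have hnot := h₀ x.1 hxs hxb₀
  -- `F = ι ∘ (e_p − e_p p)` near `x`, so `dF_x = Dι(e_p x − e_p p) ∘ De_p`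
  have hx : InPuncturedChartBall p εF x := ⟨hxs, hxbF⟩
  have hev : F =ᶠ[𝓝 x]
      fun z : punctured p => inversion (extChartAt (𝓡 4) p z.1 - extChartAt (𝓡 4) p p) :=
    Filter.eventuallyEq_of_mem
      ((Literature.Geometry.Symplectic.isOpen_setOf_inPuncturedChartBall p εF).mem_nhds hx)
      fun z hz => hF z hz.1 hz.2
  have hF' :=
    (Literature.Geometry.Symplectic.hasMFDerivAt_inversion_extChartAt_sub p x hxs).congr_of_eventuallyEq
      hev
  rw [hoff x hnot v w, hF'.mfderiv]
  rfl

end General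

/-- **Stub 4 — STANDARD END (S–M; chain rule + a radius avoiding the compact cap).**  If `F`
agrees with the inverted recentred chart `ι ∘ (e_p − e_p p)` on a punctured chart-ball at `p`, the
closed `μ`-chart-ball about `q` lies in its chart and misses `p`, and `sf` is a smooth closed
non-degenerate `2`-form on `Σ ∖ p` equal to `F*ω₀` off that closed ball, then `sf` is symplectic
and standard near `p` (`IsSymplecticStandardNearPoint p ε sf`) for some `ε`: the image of the
closed ball under `e_q⁻¹` is compact and misses `p`, so a small punctured chart-ball at `p` avoids
it; there `sf = F*ω₀` and `F = ι ∘ (e_p − e_p p)` near each point, whence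
`sf_x(v, w) = ω₀(Dι De_p v, Dι De_p w) = invertedStdForm (e_p x − e_p p) (De_p v) (De_p w)` by the
chain rule (`ι` is differentiable off `0`, and `e_p x ≠ e_p p` for `x ≠ p` in the chart source).
The carrier case of `isSymplecticStandardNearPoint_of_eq_off_closedChartBall`.
[cite: Gromov1985, §0.3.C] [cite: McDuffSalamon2012, §9.4] -/
theorem stub_standardEnd :
    ∀ (S : HomotopySphere 4) (p q : S.carrier) (F : punctured p → E4) (μ : ℝ)
      (sf : MForm (𝓡 4) (punctured p) ℝ 2),
      AgreesWithInvertedChartNear p F →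
      Metric.closedBall (extChartAt (𝓡 4) q q) μ ⊆ (extChartAt (𝓡 4) q).target →
      (∀ y ∈ Metric.closedBall (extChartAt (𝓡 4) q q) μ, (extChartAt (𝓡 4) q).symm y ≠ p) →
      IsSmoothForm sf → IsClosedForm sf →
      (∀ (x : punctured p) (v : TangentSpace (𝓡 4) x), v ≠ 0 → ∃ w, sf x ![v, w] ≠ 0) →
      (∀ x : punctured p,
        ¬ (x.1 ∈ (chartAt E4 q).source ∧ ‖extChartAt (𝓡 4) q x.1 - extChartAt (𝓡 4) q q‖ ≤ μ) →
        ∀ v w : TangentSpace (𝓡 4) x, sf x ![v, w] =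
          stdSymplecticForm (mfderiv (𝓡 4) 𝓘(ℝ, E4) F x v) (mfderiv (𝓡 4) 𝓘(ℝ, E4) F x w)) →
      ∃ ε : ℝ, IsSymplecticStandardNearPoint p ε sf := by
  intro S p q F μ sf hagree hball havoid hs hc hnd hoff
  exact isSymplecticStandardNearPoint_of_eq_off_closedChartBall p q F μ sf hagree hball havoid hs hc
    hnd hoff

end Summit.SmoothPoincare4.SmoothPoincare4.Theorems.Target.KaehlerJacket

end
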